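import Summits.Ventures.QEC.Census.CertScan
import HarnessLib

/-!
# Chunked replays for the CSS distance-certificate checker: packable chunk keys and their assembling lemmas
# (plan/CERT-FORMAT.md v1 §7, chunk key (side, first selected position[, second selected position]))

`Summits/Ventures/QEC/Census/CertScan.lean` (type-10) proves that a passing `scan` reaches every sublist
(`reaches_of_scan`) and that the replay of budget `b + 1` over a position list `L` splits by the FIRST selected
position (`reaches_of_chunks`). A single kernel evaluation (`decide +kernel`) of a scan is bounded (measured
2026-08-26, qec-search-7 EFFICIENCY D2: ≈ 10⁶ scan nodes per evaluation — the kernel's memory guard — and the default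
heartbeat budget), so the lower-bound replay of a code such as the bivariate-bicycle `[[72,12,6]]` code
(`1.5 · 10⁷` end points per side) is emitted as MANY small theorems. This file fixes the shapes of those theorems so
that the emitter (HOME/census/search-7/emit_lean.py) writes one short line per kernel evaluation and the assembling
theorem is a first-order term:

* `chunk1 test L b i` — the level-1 chunk with first selected position `i` (a `scan` of budget `b` over the positions
  after `i`, started at position `i`'s word and syndrome column); `chunk2 test L b i j` — the level-2 chunk whose
  second selected position is the `j`-th position after `i`; `chunk1R` / `chunk2R` — a RANGE of consecutive chunks
  evaluated in one go (`List.all` over `List.range'`), which is how small chunks are packed up to the evaluation cap;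
* what level-1 chunk `i` establishes is `Reaches test (L.drop (i+1)) b (L.getD i (0,0)).1 (L.getD i (0,0)).2`;
  `chunk1_sound`, `reaches_chunk1_of_chunk2` (level 2 ⇒ level 1, via `reaches_of_chunks`), `reaches_origin_of_chunk1`
  (level 1 ⇒ the whole replay from the origin `(0, 0)` with budget `b + 1`);
* bookkeeping on `∀ i, i < n → P i`: `forall_lt_zero`, `forall_lt_append`, `forall_lt_single`, `forall_of_chunk1R`,
  `forall_of_chunk2R`.

Nothing here is specific to a code; no axioms beyond the standard three; no `decide` is run in this file.
-/

namespace Summit.Ventures.QEC.Census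

/-! ## Chunk shapes (Bool, evaluated by `decide +kernel` in the emitted files) -/

/-- Level-1 chunk `i` of the replay of `test` over the position list `L`: the `scan` of budget `b` over the positions
after position `i`, started from position `i`'s (word, syndrome column). Out-of-range `i` reads `(0, 0)`. -/
def chunk1 (test : ℕ → ℕ → Bool) (L : List (ℕ × ℕ)) (b i : ℕ) : Bool :=
  scan test (L.drop (i + 1)) b (L.getD i (0, 0)).1 (L.getD i (0, 0)).2

/-- Level-2 chunk `(i, j)`: first selected position `i`, second selected position = the `j`-th position after `i`;
the `scan` of budget `b` over the later positions, started from the XOR of the two positions. -/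
def chunk2 (test : ℕ → ℕ → Bool) (L : List (ℕ × ℕ)) (b i j : ℕ) : Bool :=
  scan test ((L.drop (i + 1)).drop (j + 1)) b
    ((L.getD i (0, 0)).1 ^^^ ((L.drop (i + 1)).getD j (0, 0)).1)
    ((L.getD i (0, 0)).2 ^^^ ((L.drop (i + 1)).getD j (0, 0)).2)

/-- A packed range of level-1 chunks: `chunk1 test L b i` for `i0 ≤ i < i0 + len`, in one evaluation. -/
def chunk1R (test : ℕ → ℕ → Bool) (L : List (ℕ × ℕ)) (b i0 len : ℕ) : Bool :=
  (List.range' i0 len).all fun i => chunk1 test L b i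

/-- A packed range of level-2 chunks: `chunk2 test L b i j` for `j0 ≤ j < j0 + len`, in one evaluation. -/
def chunk2R (test : ℕ → ℕ → Bool) (L : List (ℕ × ℕ)) (b i j0 len : ℕ) : Bool :=
  (List.range' j0 len).all fun j => chunk2 test L b i j

/-! ## Assembling lemmas -/

section Assemble

variable {test : ℕ → ℕ → Bool} {L : List (ℕ × ℕ)} {b i : ℕ}

/-- A passing level-1 chunk establishes its `Reaches` statement. -/
theorem chunk1_sound (h : chunk1 test L b i = true) :
    Reaches test (L.drop (i + 1)) b (L.getD i (0, 0)).1 (L.getD i (0, 0)).2 :=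
  reaches_of_scan h

/-- In range, `getD` is `getElem`. -/
private theorem getD_eq_getElem_of_lt {α : Type*} (l : List α) (d : α) {k : ℕ} (hk : k < l.length) :
    l.getD k d = l[k] := by
  rw [List.getD_eq_getElem?_getD, List.getElem?_eq_getElem hk, Option.getD_some]

/-- **Level 2 ⇒ level 1**: if `test` holds at position `i` itself and every level-2 chunk `(i, j)`,
`j < |L| − (i + 1)`, passes with budget `b`, then level-1 chunk `i` holds with budget `b + 1`
(every nonempty continuation has a first element; `reaches_of_chunks`). The length is taken as a numeral `n`. -/
theorem reaches_chunk1_of_chunk2 (n : ℕ) (hn : (L.drop (i + 1)).length = n)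
    (h0 : test (L.getD i (0, 0)).1 (L.getD i (0, 0)).2 = true)
    (h : ∀ j, j < n → chunk2 test L b i j = true) :
    Reaches test (L.drop (i + 1)) (b + 1) (L.getD i (0, 0)).1 (L.getD i (0, 0)).2 := by
  refine reaches_of_chunks _ b _ _ h0 fun j hj => ?_
  have hs := reaches_of_scan (h j (hn ▸ hj))
  rwa [getD_eq_getElem_of_lt _ _ hj] at hs

/-- **Level 1 ⇒ the replay**: if `test` holds at the origin and every level-1 chunk `i`, `i < |L|`, holds with
budget `b`, the replay of budget `b + 1` from the origin `(0, 0)` reaches every sublist of `L`. The length is taken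
as a numeral `n`. -/
theorem reaches_origin_of_chunk1 (n : ℕ) (hn : L.length = n) (h0 : test 0 0 = true)
    (h : ∀ i, i < n → Reaches test (L.drop (i + 1)) b (L.getD i (0, 0)).1 (L.getD i (0, 0)).2) :
    Reaches test L (b + 1) 0 0 := by
  refine reaches_of_chunks L b 0 0 h0 fun i hi => ?_
  have hc := h i (hn ▸ hi)
  rwa [getD_eq_getElem_of_lt _ _ hi, ← Nat.zero_xor (L[i]).1, ← Nat.zero_xor (L[i]).2] at hc

/-! ## Bookkeeping on bounded universal statements -/

/-- The empty range. -/
theorem forall_lt_zero {P : ℕ → Prop} : ∀ i, i < 0 → P i :=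
  fun _ h => absurd h (Nat.not_lt_zero _)

/-- Appending a range `[a, c)` given as `a ≤ i < c` to a prefix `[0, a)`. -/
theorem forall_lt_append {P : ℕ → Prop} {a c : ℕ} (h1 : ∀ i, i < a → P i) (h2 : ∀ i, a ≤ i → i < c → P i) :
    ∀ i, i < c → P i :=
  fun i hi => (Nat.lt_or_ge i a).elim (h1 i) fun ha => h2 i ha hi

/-- A single index as a range `[a, a + 1)`. -/
theorem forall_lt_single {P : ℕ → Prop} (a : ℕ) (h : P a) : ∀ i, a ≤ i → i < a + 1 → P i :=
  fun _ ha hi => (Nat.le_antisymm (Nat.le_of_lt_succ hi) ha) ▸ h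

/-- Unpacking a `List.all` over `List.range'`. -/
private theorem forall_of_all_range' {f : ℕ → Bool} {a len : ℕ} (h : (List.range' a len).all f = true) :
    ∀ i, a ≤ i → i < a + len → f i = true := by
  intro i ha hi
  rw [List.all_eq_true] at h
  exact h i (List.mem_range'_1.2 ⟨ha, hi⟩)

/-- A passing packed range of level-1 chunks gives what each of them establishes. -/
theorem forall_of_chunk1R {i0 len : ℕ} (h : chunk1R test L b i0 len = true) :
    ∀ i, i0 ≤ i → i < i0 + len → Reaches test (L.drop (i + 1)) b (L.getD i (0, 0)).1 (L.getD i (0, 0)).2 :=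
  fun i ha hi => chunk1_sound (forall_of_all_range' h i ha hi)

/-- A passing packed range of level-2 chunks gives each of them. -/
theorem forall_of_chunk2R {j0 len : ℕ} (h : chunk2R test L b i j0 len = true) :
    ∀ j, j0 ≤ j → j < j0 + len → chunk2 test L b i j = true :=
  forall_of_all_range' h

end Assemble

end Summit.Ventures.QEC.Census
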